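import Summits.AtomisticToContinuum.HydrodynamicLimit.Theorems.BoxDissipativeWeakStrongRelativeEnergyStabilityGronwallIntegrablePieces
import HarnessLib

/-!
# Crux `RelativeEnergyStability` (stmt-AtomisticToContinuum-17653), line `registered`, heart stub S-X — part 9a:
# sharp domination and nonnegativity of the clamped box energy observable

Two elementary inputs of the expectation layer of S-X (Grönwall in the mean):

* `sx_obs_abs_le` — the SHARP domination `|e(s,z)| ≤ A + B · KE(z)/(N+1)` of the pathwise clamped box relative energy
  `e(s,z) = clampedRelEnergyObs σ η₁ a b ρ u θ N Φ l s z`, `s ∈ [0,τ]`, with constants depending only on the strong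
  solution on `[0,τ]` and the clamps — uniform in `N`, in the window `l` and in the datum `z` (given the exact box
  balance laws `BoxBalanceLawsFor σ N Φ l z`: box mass `1`, box energy `KE/(N+1)`, conservation of `KE`). Pointwise
  `|ℰ_Z| ≤ C(1 + |ρ̂| + ‖m̂‖ + |Ê|)` (`tz_abs_clampedRelEnergy_le`) and `‖m̂‖ ≤ ρ̂/2 + Ê` (`sx_norm_mom_le`, from
  `|v| ≤ (1 + |v|²)/2` under the nonnegative box kernel), then integrate in `x`.
* `sx_obs_nonneg` — `0 ≤ e(s,z)` as soon as the clamped energy is pointwise nonnegative at admissible box states with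
  frozen one-particle boxes of density `≤ ρs` (the output of `co_pointwise_estimate`) and `((N+1)l³)⁻¹ ≤ ρs`, for
  configurations with pairwise distinct velocities (`co_box_admissible`).

References: Březina–Feireisl 2018 §3.2; Spohn 1991 Part I Ch. 3 (box fields).
-/

noncomputable section

namespace Summit.AtomisticToContinuum.HydrodynamicLimit.Theorems.RES

open MeasureTheory Filter Set Function
open scoped Topology InnerProductSpace ENNReal
open Summit.AtomisticToContinuum.HydrodynamicLimit.Theses.BoxDissipativeWeakStrong
open Literature.MathematicalPhysics.KineticTheory Literature.Analysis.FluidPDE Literature.Analysis.FunctionSpaces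
open Literature.Analysis.FluidPDE.CompressibleEuler
open Literature.Analysis.FluidPDE.CompressibleEuler.EulerPhase
open Literature.Analysis.FluidPDE.CompressibleEuler.StrongPointData

/-! ## Pointwise facts on box states -/

/-- The box kernel is nonnegative. -/
theorem sx_boxKernel_nonneg (l : ℝ) (x y : T3) : 0 ≤ boxKernel l x y := by
  unfold boxKernel
  refine Set.indicator_nonneg (fun y' hy' => ?_) y
  rcases le_or_gt 0 l with hl | hl
  · positivity
  · exact absurd ((hy' 0).trans (by linarith : l / 2 < 0)) (not_lt.2 (norm_nonneg (y' 0 - x 0)))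

/-- **Box density and box energy are nonnegative, and `‖m̂‖ ≤ ρ̂/2 + Ê`** (from `|v| ≤ (1 + |v|²)/2` under the
nonnegative kernel). -/
theorem sx_norm_mom_le {n : ℕ} (l : ℝ) (w : Config n (Fin 3) T3) (x : T3) :
    0 ≤ (boxState l w x).1 ∧ 0 ≤ (boxState l w x).2.2 ∧
      ‖(boxState l w x).2.1‖ ≤ (boxState l w x).1 / 2 + (boxState l w x).2.2 := by
  have hK := sx_boxKernel_nonneg l x
  have hn : (0 : ℝ) ≤ (n : ℝ)⁻¹ := by positivity
  simp only [boxState, empiricalDensityField_eq_sum, empiricalMomentumField_eq_sum, empiricalEnergyField_eq_sum]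
  refine ⟨mul_nonneg hn (Finset.sum_nonneg fun i _ => hK _),
    mul_nonneg hn (Finset.sum_nonneg fun i _ => mul_nonneg (hK _) (by positivity)), ?_⟩
  calc ‖(n : ℝ)⁻¹ • ∑ i, boxKernel l x (w i).1 • (w i).2‖
      ≤ (n : ℝ)⁻¹ * ∑ i, boxKernel l x (w i).1 * ‖(w i).2‖ := by
        rw [norm_smul, Real.norm_of_nonneg hn]
        refine mul_le_mul_of_nonneg_left ((norm_sum_le _ _).trans (Finset.sum_le_sum fun i _ => ?_)) hn
        rw [norm_smul, Real.norm_of_nonneg (hK _)]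
    _ ≤ (n : ℝ)⁻¹ * ∑ i, (boxKernel l x (w i).1 / 2 + boxKernel l x (w i).1 * (‖(w i).2‖ ^ 2 / 2)) := by
        refine mul_le_mul_of_nonneg_left (Finset.sum_le_sum fun i _ => ?_) hn
        have h2 : ‖(w i).2‖ ≤ 1 / 2 + ‖(w i).2‖ ^ 2 / 2 := by nlinarith [sq_nonneg (‖(w i).2‖ - 1)]
        nlinarith [hK (w i).1, h2]
    _ = ((n : ℝ)⁻¹ * ∑ i, boxKernel l x (w i).1) / 2 +
          (n : ℝ)⁻¹ * ∑ i, boxKernel l x (w i).1 * (‖(w i).2‖ ^ 2 / 2) := by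
        rw [Finset.sum_add_distrib, ← Finset.sum_div]; ring

/-! ## Sharp domination of the observable -/

section Strong

variable {η₀ η₁ η₁B σ T : ℝ} {F χ f : ℝ → ℝ} {ρ θ : ℝ → T3 → ℝ} {u : ℝ → T3 → V3}

variable (S : AnalyticOnNhd ℝ F (Ioo (-η₀) η₀) ∧ EqOn hsExcessFreeEnergy F (Ico 0 η₀) ∧ 0 < η₁ ∧ η₁ ≤ η₁B ∧
  2 * η₁B < η₀ ∧ 0 < σ ∧
  (∀ x, 0 < x → x * σ ^ 3 ≤ η₁B → f x = hsExcessFreeEnergy (x * σ ^ 3) ∧ χ x = hsCompressibility (x * σ ^ 3)) ∧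
  (EulerEOS.monatomicExcess χ f).IsGibbs ∧ IsHardSphereEulerSolution σ T ρ u θ ∧
  ∀ t ∈ Ico 0 T, ∀ x, ρ t x * σ ^ 3 ≤ η₁ / 2)
include S

/-- **Sharp domination** `|e(s,z)| ≤ A + B · KE(z)/(N+1)` on `[0,τ]`, uniformly in `N`, the window and the datum,
given the exact box balance laws of the datum. -/
theorem sx_obs_abs_le {τ : ℝ} (hτ : τ ∈ Ico 0 T) {a b : ℝ} (hab : a ≤ b) :
    ∃ A B : ℝ, 0 ≤ A ∧ 0 ≤ B ∧ ∀ (N : ℕ)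
      (Φ : HardSphereFlow (Literature.Analysis.FluidPDE.Torus.geometry (Fin 3)) (hsDiameter σ N) (N + 1))
      (l : ℝ) (z : Config (N + 1) (Fin 3) T3), BoxBalanceLawsFor σ N Φ l z → ∀ s ∈ Icc 0 τ,
        |clampedRelEnergyObs σ η₁ a b ρ u θ N Φ l s z| ≤ A + B * (((N : ℝ) + 1)⁻¹ * configEnergy z) := by
  obtain ⟨B₀, hB₀, hbd⟩ := ia_strong_bounds S hτ
  set C₀ : ℝ := 1 + 5 * B₀ + B₀ ^ 2 + B₀ * max |a| |b| with hC₀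
  have hC₀0 : 0 ≤ C₀ := by
    have : 0 ≤ max |a| |b| := le_max_of_le_left (abs_nonneg a)
    positivity
  refine ⟨C₀ * (5 / 2), C₀ * 2, by positivity, by positivity, fun N Φ l z hBL s hs => ?_⟩
  obtain ⟨hmass, henergy, hcons, -⟩ := hBL
  set w := Φ.flow s z with hw
  -- pointwise bound by an integrable function of the box state
  have hpt : ∀ x, ‖clampedRelEnergy σ η₁ a b (ρ s x) (u s x) (θ s x) (boxState l w x)‖ ≤
      C₀ + C₀ * (3 / 2) * (boxState l w x).1 + C₀ * 2 * (boxState l w x).2.2 := by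
    intro x
    obtain ⟨hu, hμ, hθ, hp⟩ := hbd s hs x
    obtain ⟨hρ0, hE0, hm⟩ := sx_norm_mom_le l w x
    have h := tz_abs_clampedRelEnergy_le hab hB₀ hu hμ hθ hp (boxState l w x)
    rw [Real.norm_eq_abs]
    refine h.trans ?_
    rw [← hC₀, abs_of_nonneg hρ0, abs_of_nonneg hE0]
    nlinarith [hm, hC₀0]
  have hint : Integrable fun x => C₀ + C₀ * (3 / 2) * (boxState l w x).1 + C₀ * 2 * (boxState l w x).2.2 :=
    ((integrable_const C₀).add ((ip_integrable_boxFun w (G := fun _ U => U.1) fun _ => continuous_const).const_mul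
      _)).add ((ip_integrable_boxFun w (G := fun _ U => U.2.2) fun _ => continuous_const).const_mul _)
  have hI := norm_integral_le_of_norm_le hint (ae_of_all _ hpt)
  rw [Real.norm_eq_abs] at hI
  refine hI.trans (le_of_eq ?_)
  have h1 : Integrable fun x => (boxState l w x).1 :=
    ip_integrable_boxFun w (G := fun _ U => U.1) fun _ => continuous_const
  have h2 : Integrable fun x => (boxState l w x).2.2 :=
    ip_integrable_boxFun w (G := fun _ U => U.2.2) fun _ => continuous_const
  have hA := integral_add ((integrable_const C₀).add (h1.const_mul (C₀ * (3 / 2)))) (h2.const_mul (C₀ * 2))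
  have hB := integral_add (integrable_const C₀) (h1.const_mul (C₀ * (3 / 2)))
  simp only [Pi.add_apply] at hA hB
  rw [hA, hB, integral_const_mul, integral_const_mul, integral_const]
  have e1 : ∫ x, (boxState l w x).1 = 1 := hmass s
  have e2 : ∫ x, (boxState l w x).2.2 = ((N : ℝ) + 1)⁻¹ * configEnergy z := by
    rw [← hcons s]; exact henergy s
  simp only [boxState] at e1 e2 ⊢
  rw [e1, e2]
  simp
  ring

end Strong

/-! ## Nonnegativity of the observable -/

/-- **Nonnegativity of the pathwise clamped box energy** from the pointwise nonnegativity at admissible box states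
(vacuum / hot / frozen with density `≤ ρs`) when one-particle boxes are light: `((N+1)l³)⁻¹ ≤ ρs`. -/
theorem sx_obs_nonneg {σ η₁ a b ρs l : ℝ} {r₀ θ₀ : T3 → ℝ} {u₀ : T3 → V3} {N : ℕ}
    (hP : ∀ (x : T3) (U : BoxState), 0 ≤ U.1 → (U.1 = 0 → U.2.1 = 0 ∧ U.2.2 = 0) →
      0 ≤ U.2.2 - ‖U.2.1‖ ^ 2 / (2 * U.1) → (0 < U.1 → U.2.2 - ‖U.2.1‖ ^ 2 / (2 * U.1) = 0 → U.1 ≤ ρs) →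
        0 ≤ clampedRelEnergy σ η₁ a b (r₀ x) (u₀ x) (θ₀ x) U)
    (hl : 0 ≤ l) (w : Config (N + 1) (Fin 3) T3) (hdist : ∀ i j, i ≠ j → (w i).2 ≠ (w j).2)
    (hρs : ((N : ℝ) + 1)⁻¹ * (l ^ 3)⁻¹ ≤ ρs) :
    0 ≤ ∫ x, clampedRelEnergy σ η₁ a b (r₀ x) (u₀ x) (θ₀ x) (boxState l w x) := by
  refine integral_nonneg fun x => ?_
  obtain ⟨h0, hvac, hint, hfro⟩ := co_box_admissible hl w hdist x
  exact hP x _ h0 hvac hint fun hpos hE => (hfro hpos hE).trans hρs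

end Summit.AtomisticToContinuum.HydrodynamicLimit.Theorems.RES

end
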